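import Summits.MatrixMultiplication.MatrixMultiplication.Theorems.OutsiderSandwichPartialWeights
import Summits.MatrixMultiplication.MatrixMultiplication.Theorems.OutsiderSandwichCoreTwoByTwo
import Summits.MatrixMultiplication.MatrixMultiplication.Theorems.OutsiderSandwichAmortisedLaws
import HarnessLib

/-!
# Level one of the exchange table: `a(1, m) = ⌈3m/2⌉`

Route `OutsiderSandwich` (decomposition cell `decomp-mm`, lens 4 «minimal counterexample /
extremal reduction», gen 28, addendum), support for the aside leaf `BlockOneIsMM`
(stmt-MatrixMultiplication-27147).

**Theorem** (`three_mul_le_two_mul_of_amortised`).  If `⟨B⟩ ⊠ C₁ ⊵ ⟨m⟩ ⊠ ⟨2,2,2⟩` then `3m ≤ 2B`.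
With the 3:2 yield `⟨3⟩ ⊠ C₁ ⊵ ⟨2⟩ ⊠ ⟨2,2,2⟩` (`level_one_upper`) this determines the whole
first row of the amortised exchange table (`amortisedNumber_one`):
`a(1, m) = ⌈3m/2⌉ = 2, 3, 5, 6, 8, 9, …`; in particular the first open entry is
**`a(1,3) = 5`** (`amortisedNumber_one_three_eq`: `⟨4⟩ ⊠ C₁ ⋭ ⟨3⟩ ⊠ ⟨2,2,2⟩`), and the level-one
rate is exactly `ρ₁ = 3/2`.

Proof.  Flatten the target to `t♭ = ⟨m⟩ ⊠ ⟨2,2,2⟩` on the index set `Fin m × (Fin 2 × Fin 2)`; its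
input slices act as `Y ↦ (V₁Y₁, …, V_mY_m)` (`slice_flat_mulVec`) and it is concise in slice form.
Partial-weight transport (`exists_partial_weights`, formats `4m, 4m` against `4B`) gives a weight
subspace `W` with `dim W ≥ 8m − 4B` and a linear `Y`, injective on `W`, with `V_i·Y_i(V) = 0`.  The
`2 × 2` core lemma (`finrank_range_add_le_four`, applied blockwise to `V ↦ V_i` and `V ↦ Y_i(V)`)
and the two injections `U ↪ ∏ range(V ↦ V_i)`, `U ↪ ∏ range(V ↦ Y_i(V))` give `2·dim W ≤ 4m`.
Hence `8m − 4B ≤ 2m`.  Not a spectral argument: the quantum functionals are `4` on both `⟨2,2,2⟩`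
and `C₁`.

## References
* D. Coppersmith, S. Winograd, *Matrix multiplication via arithmetic progressions*,
  J. Symbolic Comput. 9 (1990) 251–280, §7 (the coupled block `C₁`). [CoppersmithWinograd1990]
* P. Bürgisser, M. Clausen, M. A. Shokrollahi, *Algebraic Complexity Theory*, Springer (1997),
  §14.4, §17.1 (restriction, conciseness, substitution). [BurgisserClausenShokrollahi1997]
-/

noncomputable section
open scoped BigOperators Matrix
set_option linter.dupNamespace false
set_option autoImplicit false

namespace Summit.MatrixMultiplication.MatrixMultiplication.Theorems.OutsiderSandwichLevelOne

open Literature.Computability.AlgebraicComplexity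
open Summit.MatrixMultiplication.MatrixMultiplication.Theorems.OutsiderSandwichNoTightExchange
open Summit.MatrixMultiplication.MatrixMultiplication.Theorems.OutsiderSandwichCoupling (coupling₁)
open Summit.MatrixMultiplication.MatrixMultiplication.Theorems.OutsiderSandwichAmortisedTable
open Summit.MatrixMultiplication.MatrixMultiplication.Theorems.OutsiderSandwichPartialWeights
open Summit.MatrixMultiplication.MatrixMultiplication.Theorems.OutsiderSandwichCoreTwoByTwo

/-! ## 1. The block count -/

section Blocks

variable {m : ℕ}

/-- **Block count.**  A subspace `U ≤ M₂(ℂ)^m` carrying a linear `Y`, injective on `U`, with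
`V_i · Y(V)_i = 0` for all `V ∈ U` and all `i`, has `dim U ≤ 2m`.
[cite: BurgisserClausenShokrollahi1997, §17.1] -/
theorem finrank_le_two_mul (U : Submodule ℂ (Fin m → Matrix (Fin 2) (Fin 2) ℂ))
    (Y : (Fin m → Matrix (Fin 2) (Fin 2) ℂ) →ₗ[ℂ] (Fin m → Matrix (Fin 2) (Fin 2) ℂ))
    (hinj : ∀ u ∈ U, Y u = 0 → u = 0) (hann : ∀ u ∈ U, ∀ i, u i * Y u i = 0) :
    Module.finrank ℂ U ≤ 2 * m := by
  classical
  let p : Fin m → (U →ₗ[ℂ] Matrix (Fin 2) (Fin 2) ℂ) :=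
    fun i => (LinearMap.proj i).comp U.subtype
  let q : Fin m → (U →ₗ[ℂ] Matrix (Fin 2) (Fin 2) ℂ) :=
    fun i => (LinearMap.proj i).comp (Y.comp U.subtype)
  have hp : ∀ i (u : U), p i u = (u : Fin m → Matrix (Fin 2) (Fin 2) ℂ) i := fun _ _ => rfl
  have hq : ∀ i (u : U), q i u = Y (u : Fin m → Matrix (Fin 2) (Fin 2) ℂ) i := fun _ _ => rfl
  have hpq : ∀ i (u : U), p i u * q i u = 0 := fun i u => by
    rw [hp, hq]; exact hann u u.2 i
  have per : ∀ i, Module.finrank ℂ (LinearMap.range (p i)) +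
      Module.finrank ℂ (LinearMap.range (q i)) ≤ 4 :=
    fun i => finrank_range_add_le_four (p i) (q i) (hpq i)
  -- injection into `∏ range (q i)`
  let Φ₁ : U →ₗ[ℂ] ((i : Fin m) → LinearMap.range (q i)) :=
    LinearMap.pi fun i => (q i).rangeRestrict
  have hΦ₁ : Function.Injective Φ₁ := by
    refine (injective_iff_map_eq_zero Φ₁).2 fun u hu => ?_
    have hY : Y (u : Fin m → Matrix (Fin 2) (Fin 2) ℂ) = 0 := by
      funext i
      have := congrFun hu i
      rw [LinearMap.pi_apply, Pi.zero_apply] at this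
      have := congrArg Subtype.val this
      rw [LinearMap.codRestrict_apply] at this
      exact this
    exact Subtype.ext (hinj u u.2 hY)
  -- injection into `∏ range (p i)`
  let Φ₂ : U →ₗ[ℂ] ((i : Fin m) → LinearMap.range (p i)) :=
    LinearMap.pi fun i => (p i).rangeRestrict
  have hΦ₂ : Function.Injective Φ₂ := by
    refine (injective_iff_map_eq_zero Φ₂).2 fun u hu => ?_
    apply Subtype.ext
    funext i
    have := congrFun hu i
    rw [LinearMap.pi_apply, Pi.zero_apply] at this
    have := congrArg Subtype.val this
    rw [LinearMap.codRestrict_apply] at this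
    exact this
  have h1 := LinearMap.finrank_le_finrank_of_injective hΦ₁
  have h2 := LinearMap.finrank_le_finrank_of_injective hΦ₂
  rw [Module.finrank_pi_fintype ℂ] at h1 h2
  have hsum : ∑ i : Fin m, (Module.finrank ℂ (LinearMap.range (p i)) +
      Module.finrank ℂ (LinearMap.range (q i))) ≤ ∑ _i : Fin m, 4 :=
    Finset.sum_le_sum fun i _ => per i
  rw [Finset.sum_add_distrib, Finset.sum_const, Finset.card_univ, Fintype.card_fin,
    smul_eq_mul] at hsum
  omega

end Blocks

/-! ## 2. The flat target `⟨m⟩ ⊠ ⟨2,2,2⟩` and its slices -/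

section Flat

variable (m : ℕ)

/-- `⟨m⟩ ⊠ ⟨2,2,2⟩` on the flat index set `Fin m × (Fin 2 × Fin 2)`.
[cite: BurgisserClausenShokrollahi1997, §14.4] -/
abbrev flat : Fin m × (Fin 2 × Fin 2) → Fin m × (Fin 2 × Fin 2) → Fin m × (Fin 2 × Fin 2) → ℂ :=
  kroneckerTensor (unitTensor ℂ m) (matMulTensor ℂ 2 2 2)

/-- `⟨m⟩ ⊠ ⟨2,2,2⟩^{⊠1} ⊵ flat`. [cite: BurgisserClausenShokrollahi1997, §14.4] -/
theorem tgt_restrictsTo_flat : TensorRestrictsTo (tgt 1 m) (flat m) := by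
  have hfun : flat m = fun a b c => tgt 1 m (a.1, fun _ => a.2) (b.1, fun _ => b.2)
      (c.1, fun _ => c.2) := by
    funext a b c
    dsimp only [flat, tgt]
    rw [kroneckerTensor_apply, kroneckerTensor_apply, kroneckerPow_apply, Fin.prod_univ_one]
  rw [hfun]
  exact tensorRestrictsTo_precomp (tgt 1 m) _ _ _

/-- Entries of the input slices of `flat`. [cite: BurgisserClausenShokrollahi1997, §14.4] -/
theorem slice_flat_apply (w : Fin m × (Fin 2 × Fin 2) → ℂ) (a c : Fin m × (Fin 2 × Fin 2)) :
    slice (flat m) w a c =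
      if c.2.2 = a.2.2 ∧ c.1 = a.1 then w (a.1, (a.2.1, c.2.1)) else 0 := by
  classical
  have hM : ∀ (x y z : Fin 2 × Fin 2), matMulTensor ℂ 2 2 2 x y z =
      if x.1 = y.1 ∧ y.2 = z.1 ∧ x.2 = z.2 then 1 else 0 := fun _ _ _ => rfl
  rw [slice_apply, Finset.sum_eq_single (a.1, (a.2.1, c.2.1))]
  · dsimp only [flat]
    rw [kroneckerTensor_apply, unitTensor_apply, hM]
    by_cases h : c.2.2 = a.2.2 ∧ c.1 = a.1
    · rw [if_pos h, if_pos ⟨rfl, h.2.symm⟩, if_pos ⟨rfl, rfl, h.1.symm⟩, mul_one, mul_one]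
    · rw [if_neg h]
      by_cases h1 : c.1 = a.1
      · have h2 : ¬ c.2.2 = a.2.2 := fun h2 => h ⟨h2, h1⟩
        rw [if_pos ⟨rfl, h1.symm⟩, one_mul, if_neg (fun hh => h2 hh.2.2.symm), mul_zero]
      · rw [if_neg (fun hh => h1 hh.2.symm), zero_mul, mul_zero]
  · intro b _ hb
    dsimp only [flat]
    rw [kroneckerTensor_apply, unitTensor_apply, hM]
    by_cases h1 : a.1 = b.1 ∧ b.1 = c.1
    · rw [if_pos h1, one_mul]
      by_cases h2 : a.2.1 = b.2.1 ∧ b.2.2 = c.2.1 ∧ a.2.2 = c.2.2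
      · exfalso; apply hb
        exact Prod.ext h1.1.symm (Prod.ext h2.1.symm h2.2.1)
      · rw [if_neg h2, mul_zero]
    · rw [if_neg h1, zero_mul, mul_zero]
  · intro h; exact absurd (Finset.mem_univ _) h

/-- The input slices of `flat` act blockwise as `Y ↦ V·Y`:
`(S_w ζ)(i,(p,q)) = ∑_j w(i,(p,j)) ζ(i,(j,q))`. [cite: BurgisserClausenShokrollahi1997, §14.4] -/
theorem slice_flat_mulVec (w ζ : Fin m × (Fin 2 × Fin 2) → ℂ) (i : Fin m) (p q : Fin 2) :
    (slice (flat m) w).mulVec ζ (i, (p, q)) = ∑ j : Fin 2, w (i, (p, j)) * ζ (i, (j, q)) := by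
  classical
  simp only [Matrix.mulVec, dotProduct, slice_flat_apply, ite_mul, zero_mul,
    Fintype.sum_prod_type]
  simp only [ite_and, Finset.sum_ite_eq', Finset.mem_univ, if_true]
  rw [Finset.sum_comm]
  simp only [Finset.sum_ite_eq', Finset.mem_univ, if_true]

/-- `flat` is input-concise in slice form. [cite: BurgisserClausenShokrollahi1997, §14.4] -/
theorem flat_weight_eq_zero (w : Fin m × (Fin 2 × Fin 2) → ℂ) (h : slice (flat m) w = 0) :
    w = 0 := by
  funext x
  obtain ⟨i, p, j⟩ := x
  have e := congrFun (congrFun h (i, (p, 0))) (i, (j, 0))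
  rw [slice_flat_apply, if_pos ⟨rfl, rfl⟩, Matrix.zero_apply] at e
  exact e

/-- `flat` is output-concise in slice form. [cite: BurgisserClausenShokrollahi1997, §14.4] -/
theorem flat_vec_eq_zero (ζ : Fin m × (Fin 2 × Fin 2) → ℂ)
    (h : ∀ w, (slice (flat m) w).mulVec ζ = 0) : ζ = 0 := by
  classical
  funext x
  obtain ⟨i, p, q⟩ := x
  have e := congrFun (h fun b => if b.2.1 = b.2.2 then 1 else 0) (i, (p, q))
  rw [slice_flat_mulVec, Pi.zero_apply] at e
  simp only [ite_mul, one_mul, zero_mul, Finset.sum_ite_eq, Finset.mem_univ, if_true] at e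
  exact e

/-- Blocks: the flat weight/output space as `m`-tuples of `2 × 2` matrices.
[cite: BurgisserClausenShokrollahi1997, §14.4] -/
def blocks : (Fin m × (Fin 2 × Fin 2) → ℂ) ≃ₗ[ℂ] (Fin m → Matrix (Fin 2) (Fin 2) ℂ) where
  toFun v := fun i => Matrix.of fun p j => v (i, (p, j))
  invFun V := fun b => V b.1 b.2.1 b.2.2
  map_add' v v' := by funext i; ext p j; rfl
  map_smul' c v := by funext i; ext p j; rfl
  left_inv v := by funext b; rfl
  right_inv V := by funext i; ext p j; rfl

/-- `blocks` entries. [cite: BurgisserClausenShokrollahi1997, §14.4] -/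
@[simp] theorem blocks_apply (v : Fin m × (Fin 2 × Fin 2) → ℂ) (i : Fin m) (p j : Fin 2) :
    blocks m v i p j = v (i, (p, j)) := rfl

/-- Block products are the slice action. [cite: BurgisserClausenShokrollahi1997, §14.4] -/
theorem blocks_mul_blocks (w ζ : Fin m × (Fin 2 × Fin 2) → ℂ) (i : Fin m) (p q : Fin 2) :
    (blocks m w i * blocks m ζ i) p q = (slice (flat m) w).mulVec ζ (i, (p, q)) := by
  rw [slice_flat_mulVec, Matrix.mul_apply]
  rfl

end Flat

/-! ## 3. The level-one law -/

/-- **Level one**: `⟨B⟩ ⊠ C₁ ⊵ ⟨m⟩ ⊠ ⟨2,2,2⟩ ⟹ 3m ≤ 2B`. [cite: CoppersmithWinograd1990, §7] -/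
theorem three_mul_le_two_mul_of_amortised {B m : ℕ} (h : Amortised 1 B m) : 3 * m ≤ 2 * B := by
  classical
  have hres : TensorRestrictsTo (src 1 B) (flat m) :=
    ((src_restrictsTo_coupling 1 B).trans h).trans (tgt_restrictsTo_flat m)
  obtain ⟨W, Y, hdim, hinj, hann⟩ :=
    exists_partial_weights (le_refl 1) (flat_weight_eq_zero m) (flat_vec_eq_zero m) hres
  let Θ := blocks m
  let U : Submodule ℂ (Fin m → Matrix (Fin 2) (Fin 2) ℂ) := W.map (Θ : _ →ₗ[ℂ] _)
  let Yb : (Fin m → Matrix (Fin 2) (Fin 2) ℂ) →ₗ[ℂ] (Fin m → Matrix (Fin 2) (Fin 2) ℂ) :=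
    (Θ : _ →ₗ[ℂ] _) ∘ₗ Y ∘ₗ (Θ.symm : _ →ₗ[ℂ] _)
  have hYb : ∀ w, Yb (Θ w) = Θ (Y w) := fun w => by
    simp only [Yb, LinearMap.comp_apply, LinearEquiv.coe_coe, LinearEquiv.symm_apply_apply]
  have hU : ∀ u ∈ U, ∃ w ∈ W, Θ w = u := fun u hu => Submodule.mem_map.1 hu
  have hinj' : ∀ u ∈ U, Yb u = 0 → u = 0 := by
    intro u hu h0
    obtain ⟨w, hw, rfl⟩ := hU u hu
    rw [hYb, LinearEquiv.map_eq_zero_iff] at h0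
    rw [hinj w hw h0, map_zero]
  have hann' : ∀ u ∈ U, ∀ i, u i * Yb u i = 0 := by
    intro u hu i
    obtain ⟨w, hw, rfl⟩ := hU u hu
    rw [hYb]
    ext p q
    rw [Matrix.zero_apply]
    change (blocks m w i * blocks m (Y w) i) p q = 0
    rw [blocks_mul_blocks, hann w hw, Pi.zero_apply]
  have hcore := finrank_le_two_mul U Yb hinj' hann'
  have hfin : Module.finrank ℂ U = Module.finrank ℂ W := LinearEquiv.finrank_map_eq Θ W
  have hc1 : Fintype.card (Fin m × (Fin 2 × Fin 2)) = 4 * m := by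
    simp only [Fintype.card_prod, Fintype.card_fin]; ring
  have hc2 : Fintype.card (J 1 B) = 4 * B := by
    simp only [J, Fintype.card_prod, Fintype.card_fun, Fintype.card_fin]; ring
  rw [hc1, hc2] at hdim
  omega

/-- **`⟨4⟩ ⊠ C₁ ⋭ ⟨3⟩ ⊠ ⟨2,2,2⟩`.** [cite: CoppersmithWinograd1990, §7] -/
theorem not_amortised_one_four_three : ¬ Amortised 1 4 3 := fun h => by
  have := three_mul_le_two_mul_of_amortised h
  omega

/-- **The first row of the exchange table**: `a(1, m) = ⌈3m/2⌉`.
[cite: CoppersmithWinograd1990, §7] -/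
theorem amortisedNumber_one (m : ℕ) : amortisedNumber 1 m = (3 * m + 1) / 2 := by
  have h1 := three_mul_le_two_mul_of_amortised (amortised_amortisedNumber 1 m)
  have h2 := level_one_upper m
  omega

/-- **`a(1, 3) = 5`** (the entry left open by `amortisedNumber_one_three`).
[cite: CoppersmithWinograd1990, §7] -/
theorem amortisedNumber_one_three_eq : amortisedNumber 1 3 = 5 := by
  rw [amortisedNumber_one]

/-- `a(1, 5) = 8`, `a(1, 6) = 9`. [cite: CoppersmithWinograd1990, §7] -/
theorem amortisedNumber_one_five_six : amortisedNumber 1 5 = 8 ∧ amortisedNumber 1 6 = 9 := by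
  rw [amortisedNumber_one, amortisedNumber_one]; exact ⟨rfl, rfl⟩

/-- Level one in the semiring `T(ℂ)`: `m·[⟨2,2,2⟩] ≤ B·[C₁] ⟹ 3m ≤ 2B`, and conversely for
`B = ⌈3m/2⌉`. [cite: ChristandlVranaZuiddam2023, §1.1] -/
theorem level_one_iff (B m : ℕ) :
    (m : TensorClass ℂ) * TensorClass.mk (matMulTensor ℂ 2 2 2) ≤
      (B : TensorClass ℂ) * TensorClass.mk coupling₁ ↔ 3 * m ≤ 2 * B := by
  have h := amortised_iff 1 B m
  rw [pow_one, pow_one] at h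
  rw [← h, amortised_iff_amortisedNumber_le, amortisedNumber_one]
  omega

end Summit.MatrixMultiplication.MatrixMultiplication.Theorems.OutsiderSandwichLevelOne
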